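import Summits.CriticalPhenomena.PercolationContinuityZ3.Theorems.PercNearOneGluingNoHeavyLowerTailSahiGridThreeKernel

/-!
# `NoHeavyLowerTail` (crux stmt-CriticalPhenomena-4575), Sahi programme P1: the FINITE CERTIFICATE — tri-coefficient positivity of
# the three-copy pattern kernel on the 27-point cube `[3]³` (`sStar A B C ≥ 0` for all up-sets), part 1: machinery and first half

Support file (Sahi cell, seat `prim-sahi-p1`, generation 6; `--supports stmt-CriticalPhenomena-4575`).  COMPUTATIONAL: `native_decide`
evaluations (`Lean.ofReduceBool`) of Boolean checks whose meaning is proved here in the kernel; no `sorry`.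

WHAT IS CERTIFIED.  With `sStar`, `U`, `upVecs` from `…SahiGridThreeKernel` (the 980 up-sets of the small cube `P3 = Fin 3 → Fin 3`
are `U upVecs[k]`, `k < 980`, sorted by size): for all index triples `i ≤ j ≤ k`, `0 ≤ sStar (U upVecs[i]) (U upVecs[j]) (U upVecs[k])`
(157 345 860 sorted triples; minimum `0`).  By the trilinear expansion `sStar A B C = Σ_{x∈A,y∈B,z∈C} T(x,y,z)` (`T = TI` on indices,
a table of `27³` integers) the check is organised as: for each `i`, the `27×27` array `V_i(y,z) = Σ_{x ∈ A_i} T(x,y,z)`; for each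
`j ≥ i`, the weight vector `W_{ij}(z) = Σ_{y ∈ B_j} V_i(y,z)`; then ALL sums `S(k) = Σ_{z ∈ C_k} W_{ij}(z)`, `k ≥ j`, by the recursion
`S(k) = S(succ k) − W_{ij}(spt k)` down a chain `C_{succ k} = C_k ∪ {spt k}` (tables `succT`, `sptT`, verified in `table_facts`), each
recursion step and each sign `S(k) ≥ 0` being RE-VERIFIED by the Boolean check (so only the verification, not the search, is trusted).
This file: masks and their bridge to membership (`bitU_maskOf`), the `T` table, `V`/`W`/`S` machinery with specification lemmas,
the chain tables, the soundness lemma `nonneg_of_checkChunk`, and the first two of six chunks.  Parts 2, 3 (`…SahiGridThreeCheckB`,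
`…SahiGridThreeCheckTwo`) run the remaining chunks and assemble `sStar_nonneg_of_isUpperSet`.  Outside Lean the same numbers were obtained by two
independent programs (C: 7.8 s; Python exact polynomial expansion) and kit job j092188. [this work]
-/

namespace Summit.CriticalPhenomena.PercolationContinuityZ3.Theorems.SahiGrid3

open Finset

/-! ### List / finset plumbing -/

/-- Total array access (default `0`). [this work] -/
def agetZ (T : Array ℤ) (i : ℕ) : ℤ := if h : i < T.size then T[i] else 0

/-- Total array access (default `0`). [this work] -/
def agetN (T : Array ℕ) (i : ℕ) : ℕ := if h : i < T.size then T[i] else 0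

/-- Total array access (default `0`). [this work] -/
def agetU (T : Array UInt64) (i : ℕ) : UInt64 := if h : i < T.size then T[i] else 0

/-- `foldl` with a conditional add is a sum. [folklore] -/
theorem foldl_cond_add (b : ℕ → Bool) (g : ℕ → ℤ) : ∀ (l : List ℕ) (s : ℤ),
    l.foldl (fun s n => if b n then s + g n else s) s = s + (l.map fun n => if b n then g n else 0).sum
  | [], s => by simp
  | n :: l, s => by
    rw [List.foldl_cons, List.map_cons, List.sum_cons]
    by_cases h : b n = true
    · rw [if_pos h, foldl_cond_add b g l, if_pos h, add_assoc]
    · rw [if_neg h, foldl_cond_add b g l, if_neg h, zero_add]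

/-- `foldl (· + f ·)` is a sum. [folklore] -/
theorem foldl_add_eq' (f : ℕ → ℤ) : ∀ (l : List ℕ) (s : ℤ), l.foldl (fun s n => s + f n) s = s + (l.map f).sum
  | [], s => by simp
  | p :: l, s => by rw [List.foldl_cons, foldl_add_eq' f l, List.map_cons, List.sum_cons, add_assoc]

/-- Sum over a filtered list as a sum with indicators. [folklore] -/
theorem sum_map_filter (b : ℕ → Bool) (g : ℕ → ℤ) : ∀ l : List ℕ,
    ((l.filter b).map g).sum = (l.map fun n => if b n then g n else 0).sum
  | [] => by simp
  | n :: l => by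
    rw [List.filter_cons, List.map_cons, List.sum_cons]
    by_cases h : b n = true
    · rw [if_pos h, List.map_cons, List.sum_cons, sum_map_filter b g l, if_pos h]
    · rw [if_neg h, sum_map_filter b g l, if_neg h, zero_add]

/-- List sums over `List.range` are finset sums over `Finset.range`. [folklore] -/
theorem sum_map_range (f : ℕ → ℤ) : ∀ m : ℕ, ((List.range m).map f).sum = ∑ i ∈ Finset.range m, f i
  | 0 => by simp
  | m + 1 => by
    rw [List.range_succ, List.map_append, List.sum_append, sum_map_range f m, Finset.sum_range_succ, List.map_singleton,
      List.sum_singleton]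

/-- Reindexing a sum over the 27 indices by the points of the small cube. [this work] -/
theorem sum_range27_eq_sum_univ (g : ℕ → ℤ) : ∑ n ∈ Finset.range 27, g n = ∑ q : P3, g (pidx q) :=
  (Finset.sum_nbij' (fun q => pidx q) (fun n => pnt n) (fun q _ => Finset.mem_range.2 (pidx_lt q)) (fun _ _ => mem_univ _)
    (fun q _ => pnt_pidx q) (fun _ hn => pidx_pnt (Finset.mem_range.1 hn)) (fun _ _ => rfl)).symm

/-! ### Masks -/

/-- The 27-bit mask of `U v` (bit `n` = membership of the point with index `n`). [this work] -/
def maskOf (v : List ℕ) : UInt64 :=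
  (List.range 27).foldl (fun m n => if pnt n ∈ U v then m ||| ((1 : UInt64) <<< UInt64.ofNat n) else m) 0

/-- Bit `p` of a mask. [this work] -/
def bitU (m : UInt64) (p : ℕ) : Bool := ((m >>> UInt64.ofNat p) &&& (1 : UInt64)) == (1 : UInt64)

/-- The masks encode membership (COMPUTATIONAL, `native_decide`: 980 × 27 bit tests). [this work] -/
theorem bitU_maskOf : ∀ v ∈ upVecs, ∀ q : P3, bitU (maskOf v) (pidx q) = decide (q ∈ U v) := by
  have h : (upVecs.all fun v => let m := maskOf v; decide (∀ q : P3, bitU m (pidx q) = decide (q ∈ U v))) = true := by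
    native_decide
  intro v hv
  rw [List.all_eq_true] at h
  exact of_decide_eq_true (h v hv)

/-- Indicator sums over mask bits are finset sums over the up-set. [this work] -/
theorem sum_bit_eq {v : List ℕ} (hv : v ∈ upVecs) (g : ℕ → ℤ) :
    ((List.range 27).map fun n => if bitU (maskOf v) n then g n else 0).sum = ∑ q ∈ U v, g (pidx q) := by
  rw [sum_map_range, sum_range27_eq_sum_univ, ← Finset.sum_filter]
  refine Finset.sum_congr ?_ fun _ _ => rfl
  ext q
  rw [Finset.mem_filter, bitU_maskOf v hv q]
  simp

/-- Member indices of a mask. [this work] -/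
def membIdx (m : UInt64) : List ℕ := (List.range 27).filter (bitU m)

/-! ### The `T` table, `V`, `W` -/

/-- The table of the `27³` trilinear coefficients `TI x y z` at index `729x + 27y + z`. [this work] -/
def Ttab : Array ℤ := Array.ofFn fun n : Fin 19683 => TI ((n : ℕ) / 729) ((n : ℕ) / 27 % 27) ((n : ℕ) % 27)

/-- Table lookup is `TI`. [this work] -/
theorem Ttab_get {x y z : ℕ} (hx : x < 27) (hy : y < 27) (hz : z < 27) : agetZ Ttab (x * 729 + y * 27 + z) = TI x y z := by
  have hsz : Ttab.size = 19683 := by unfold Ttab; rw [Array.size_ofFn]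
  have hi : x * 729 + y * 27 + z < Ttab.size := by rw [hsz]; omega
  unfold agetZ
  rw [dif_pos hi]
  unfold Ttab
  rw [Array.getElem_ofFn]
  have e1 : (x * 729 + y * 27 + z) / 729 = x := by omega
  have e2 : (x * 729 + y * 27 + z) / 27 % 27 = y := by omega
  have e3 : (x * 729 + y * 27 + z) % 27 = z := by omega
  simp only [e1, e2, e3]

/-- `V_A(y,z) = Σ_{x ∈ A} T(x,y,z)` as a `729`-array (index `27y + z`), from the member list of `A`. [this work] -/
def Varr (T : Array ℤ) (membA : List ℕ) : Array ℤ :=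
  Array.ofFn fun e : Fin 729 => membA.foldl (fun s x => s + agetZ T (x * 729 + e)) 0

/-- `W_{AB}(z) = Σ_{y ∈ B} V_A(y,z)` as a `27`-array, from the member list of `B`. [this work] -/
def Warr (V : Array ℤ) (membB : List ℕ) : Array ℤ :=
  Array.ofFn fun z : Fin 27 => membB.foldl (fun s y => s + agetZ V (y * 27 + z)) 0

/-- The specification of `W`: `W_{AB}(z) = Σ_{x ∈ A} Σ_{y ∈ B} T(x,y,z)`. [this work] -/
def Wspec (A B : Finset P3) (z : P3) : ℤ := ∑ x ∈ A, ∑ y ∈ B, TI (pidx x) (pidx y) (pidx z)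

/-- `Varr` computes `Σ_{x∈A} T`. [this work] -/
theorem Varr_get {v : List ℕ} (hv : v ∈ upVecs) {y z : ℕ} (hy : y < 27) (hz : z < 27) :
    agetZ (Varr Ttab (membIdx (maskOf v))) (y * 27 + z) = ∑ x ∈ U v, TI (pidx x) y z := by
  have hsz : (Varr Ttab (membIdx (maskOf v))).size = 729 := by unfold Varr; rw [Array.size_ofFn]
  have hi : y * 27 + z < (Varr Ttab (membIdx (maskOf v))).size := by rw [hsz]; omega
  unfold agetZ
  rw [dif_pos hi]
  unfold Varr membIdx
  rw [Array.getElem_ofFn, foldl_add_eq', zero_add, sum_map_filter, sum_bit_eq hv]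
  refine Finset.sum_congr rfl fun x _ => ?_
  show agetZ Ttab (pidx x * 729 + (y * 27 + z)) = _
  rw [← Nat.add_assoc]
  exact Ttab_get (pidx_lt x) hy hz

/-- `Warr` computes `Wspec`. [this work] -/
theorem Warr_get {v w : List ℕ} (hv : v ∈ upVecs) (hw : w ∈ upVecs) (z : P3) :
    agetZ (Warr (Varr Ttab (membIdx (maskOf v))) (membIdx (maskOf w))) (pidx z) = Wspec (U v) (U w) z := by
  have hsz : (Warr (Varr Ttab (membIdx (maskOf v))) (membIdx (maskOf w))).size = 27 := by unfold Warr; rw [Array.size_ofFn]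
  have hi : pidx z < (Warr (Varr Ttab (membIdx (maskOf v))) (membIdx (maskOf w))).size := by rw [hsz]; exact pidx_lt z
  unfold agetZ Wspec
  rw [dif_pos hi]
  unfold Warr
  rw [Array.getElem_ofFn]
  unfold membIdx
  rw [foldl_add_eq', zero_add, sum_map_filter, sum_bit_eq hw, Finset.sum_comm]
  refine Finset.sum_congr rfl fun y _ => ?_
  show agetZ (Varr Ttab (membIdx (maskOf v))) (pidx y * 27 + pidx z) = _
  exact Varr_get hv (pidx_lt y) (pidx_lt z)

/-- `Σ_{z ∈ C} W_{AB}(z) = sStar A B C`. [this work] -/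
theorem sum_Wspec (A B C : Finset P3) : ∑ z ∈ C, Wspec A B z = sStar A B C := by
  unfold Wspec
  rw [sStar_eq_sum_single, Finset.sum_comm]
  refine Finset.sum_congr rfl fun x _ => ?_
  rw [Finset.sum_comm]
  refine Finset.sum_congr rfl fun y _ => Finset.sum_congr rfl fun z _ => ?_
  exact TI_pidx x y z

/-! ### The chain tables `succT`, `sptT` and all the sums `S(k)` -/

/-- The masks of the 980 up-sets, as an array. [this work] -/
def maskArr : Array UInt64 := (upVecs.map maskOf).toArray

/-- `maskArr[i] = maskOf upVecs[i]`, `getD` form (COMPUTATIONAL, `native_decide`; stated computationally to keep the kernel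
away from the 980-element list). [this work] -/
theorem maskArr_get_all : ∀ i ∈ List.range 980, agetU maskArr i = maskOf (upVecs.getD i []) := by
  have h : (let M := maskArr; let L := upVecs; (List.range 980).all fun i => agetU M i == maskOf (L.getD i [])) = true := by
    native_decide
  intro i hi
  rw [List.all_eq_true] at h
  exact beq_iff_eq.1 (h i hi)

/-- Search (untrusted) for a successor: an index `k' > k` with `C_{k'} = C_k ∪ {p}`; returns `(k', p)`. [this work] -/
def findSucc (M : Array UInt64) (k : ℕ) : ℕ × ℕ :=
  let m := agetU M k
  match (List.range' (k + 1) (979 - k)).findSome? fun k' =>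
      (List.range 27).findSome? fun p =>
        if !bitU m p && agetU M k' == (m ||| ((1 : UInt64) <<< UInt64.ofNat p)) then some (k', p) else none with
  | some r => r
  | none => (0, 0)

/-- The successor table. [this work] -/
def succT : Array ℕ := let M := maskArr; Array.ofFn fun k : Fin 980 => (findSucc M k).1

/-- The added-point table. [this work] -/
def sptT : Array ℕ := let M := maskArr; Array.ofFn fun k : Fin 980 => (findSucc M k).2

/-- **The chain tables are correct** (COMPUTATIONAL, `native_decide`): for `k < 979`, `succT[k] ∈ (k, 980)`, `sptT[k] < 27`,
and `U upVecs[succT k] = insert (pnt sptT[k]) (U upVecs[k])` with `pnt sptT[k] ∉ U upVecs[k]`. [this work] -/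
theorem table_facts : ∀ k ∈ List.range 979,
    k < agetN succT k ∧ agetN succT k < 980 ∧ agetN sptT k < 27 ∧
      U (upVecs.getD (agetN succT k) []) = insert (pnt (agetN sptT k)) (U (upVecs.getD k [])) ∧
      pnt (agetN sptT k) ∉ U (upVecs.getD k []) := by
  have h : (let sT := succT; let pT := sptT; let L := upVecs;
      (List.range 979).all fun k => decide (k < agetN sT k ∧ agetN sT k < 980 ∧ agetN pT k < 27 ∧
        U (L.getD (agetN sT k) []) = insert (pnt (agetN pT k)) (U (L.getD k [])) ∧
        pnt (agetN pT k) ∉ U (L.getD k []))) = true := by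
    native_decide
  intro k hk
  rw [List.all_eq_true] at h
  exact of_decide_eq_true (h k hk)

/-- There are `980` monotone threshold vectors (COMPUTATIONAL). [this work] -/
theorem length_upVecs : upVecs.length = 980 := by native_decide

/-- `upVecs.getD k [] = upVecs[k]`. [this work] -/
theorem upVecs_getD {k : ℕ} (hk : k < upVecs.length) : upVecs.getD k [] = upVecs[k] := by
  rw [List.getD_eq_getElem?_getD, List.getElem?_eq_getElem hk, Option.getD_some]

/-- `maskArr[i] = maskOf upVecs[i]`. [this work] -/
theorem maskArr_get {i : ℕ} (hi : i < upVecs.length) : agetU maskArr i = maskOf (upVecs[i]) := by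
  rw [← upVecs_getD hi]
  exact maskArr_get_all i (List.mem_range.2 (by rw [length_upVecs] at hi; exact hi))

/-- The sums `S(k)`, `k = 979, 978, …, j` by the chain recursion (untrusted; re-verified by `verifyS`). [this work] -/
def dpS (W : Array ℤ) (top : ℤ) (sT pT : Array ℕ) (j : ℕ) : Array ℤ :=
  (List.range (979 - j)).foldl (fun S t =>
      let k := 978 - t
      S.set! k (agetZ S (agetN sT k) - agetZ W (agetN pT k)))
    ((Array.replicate 980 (0 : ℤ)).set! 979 top)

/-- The trusted verification of the sums: top value, each recursion step, and each sign, for `k ∈ [j, 980)`. [this work] -/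
def verifyS (W S : Array ℤ) (top : ℤ) (sT pT : Array ℕ) (j : ℕ) : Bool :=
  decide (agetZ S 979 = top) &&
    (List.range' j (980 - j)).all fun k =>
      (k == 979 || decide (agetZ S k = agetZ S (agetN sT k) - agetZ W (agetN pT k))) && decide (0 ≤ agetZ S k)

/-- The top sum `Σ_{z ∈ C_979} W(z)` from the mask. [this work] -/
def topSum (mTop : UInt64) (W : Array ℤ) : ℤ :=
  (List.range 27).foldl (fun s n => if bitU mTop n then s + agetZ W n else s) 0

/-- The check of all pairs `(i, j)`, `i ∈ [lo, lo+cnt)`, `j ∈ [i, 980)`, and all `k ∈ [j, 980)` (constants passed once). [this work] -/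
def checkChunk (lo cnt : ℕ) : Bool :=
  let M := maskArr
  let T := Ttab
  let sT := succT
  let pT := sptT
  let mTop := agetU M 979
  (List.range' lo cnt).all fun i =>
    let V := Varr T (membIdx (agetU M i))
    (List.range' i (980 - i)).all fun j =>
      let W := Warr V (membIdx (agetU M j))
      let top := topSum mTop W
      verifyS W (dpS W top sT pT j) top sT pT j

/-- Unpacking `verifyS`: the verified recursion determines every `S(k)`, `k ∈ [j,980)`, as `Σ_{z ∈ C_k} W(z)`, and it is `≥ 0`.
[this work] -/
theorem verifyS_sound {W S : Array ℤ} {top : ℤ} {j : ℕ} (h : verifyS W S top succT sptT j = true)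
    (htop : top = ∑ z ∈ U (upVecs.getD 979 []), agetZ W (pidx z)) :
    ∀ d k : ℕ, k + d = 979 → j ≤ k → agetZ S k = ∑ z ∈ U (upVecs.getD k []), agetZ W (pidx z) ∧ 0 ≤ agetZ S k := by
  unfold verifyS at h
  rw [Bool.and_eq_true, decide_eq_true_eq, List.all_eq_true] at h
  have hstep : ∀ k, j ≤ k → k < 980 →
      (k = 979 ∨ agetZ S k = agetZ S (agetN succT k) - agetZ W (agetN sptT k)) ∧ 0 ≤ agetZ S k := by
    intro k hjk hk
    have hk' := h.2 k (List.mem_range'_1.2 ⟨hjk, by omega⟩)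
    rw [Bool.and_eq_true, Bool.or_eq_true, beq_iff_eq, decide_eq_true_eq, decide_eq_true_eq] at hk'
    exact hk'
  intro d
  induction d using Nat.strong_induction_on with
  | _ d ih =>
    intro k hkd hjk
    have hk980 : k < 980 := by omega
    obtain ⟨hrec, hnn⟩ := hstep k hjk hk980
    refine ⟨?_, hnn⟩
    by_cases hk979 : k = 979
    · subst hk979; rw [h.1, htop]
    rcases hrec with h979 | hrec
    · exact absurd h979 hk979
    have hkr : k ∈ List.range 979 := List.mem_range.2 (by omega)
    obtain ⟨hlt, h980, h27, hU, hnot⟩ := table_facts k hkr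
    have hih := (ih (979 - agetN succT k) (by omega) (agetN succT k) (by omega) (by omega)).1
    rw [hrec, hih, hU, Finset.sum_insert hnot, pidx_pnt h27]
    ring

/-- The top sum is `Σ_{z ∈ C_979} W(z)`. [this work] -/
theorem topSum_eq (W : Array ℤ) : topSum (agetU maskArr 979) W = ∑ z ∈ U (upVecs.getD 979 []), agetZ W (pidx z) := by
  have h979 : 979 < upVecs.length := by rw [length_upVecs]; omega
  unfold topSum
  rw [foldl_cond_add, zero_add, maskArr_get h979, sum_bit_eq (List.getElem_mem h979), upVecs_getD h979]

/-- **Soundness of a chunk**: `checkChunk lo cnt = true` gives `0 ≤ sStar (U upVecs[i]) (U upVecs[j]) (U upVecs[k])` for all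
`i ∈ [lo, lo+cnt)`, `i ≤ j ≤ k < 980`. [this work] -/
theorem nonneg_of_checkChunk {lo cnt : ℕ} (h : checkChunk lo cnt = true) {i j k : ℕ} (hlo : lo ≤ i) (hi : i < lo + cnt)
    (hij : i ≤ j) (hjk : j ≤ k) (hk : k < upVecs.length) :
    0 ≤ sStar (U (upVecs[i]'(lt_of_le_of_lt (hij.trans hjk) hk))) (U (upVecs[j]'(lt_of_le_of_lt hjk hk))) (U (upVecs[k])) := by
  have hk980 : k < 980 := by rw [← length_upVecs]; exact hk
  have hiu : i < upVecs.length := lt_of_le_of_lt (hij.trans hjk) hk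
  have hju : j < upVecs.length := lt_of_le_of_lt hjk hk
  unfold checkChunk at h
  simp only [List.all_eq_true, List.mem_range'_1] at h
  have h1 := h i ⟨hlo, by omega⟩ j ⟨hij, by omega⟩
  rw [maskArr_get hiu, maskArr_get hju, topSum_eq] at h1
  obtain ⟨hS, hnn⟩ := verifyS_sound h1 rfl (979 - k) k (by omega) hjk
  rw [hS, upVecs_getD hk] at hnn
  rw [← sum_Wspec]
  refine le_of_le_of_eq hnn (Finset.sum_congr rfl fun z _ => ?_)
  exact Warr_get (List.getElem_mem hiu) (List.getElem_mem hju) z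

/-! ### The first two of six chunks (each ≈ 1/6 of the work) -/

/-- THE CERTIFICATE, chunk 1: first indices `[0, 66)` (COMPUTATIONAL, `native_decide`). [this work] -/
theorem checkChunk_1 : checkChunk 0 66 = true := by native_decide

/-- THE CERTIFICATE, chunk 2: first indices `[66, 141)` (COMPUTATIONAL, `native_decide`). [this work] -/
theorem checkChunk_2 : checkChunk 66 75 = true := by native_decide

end Summit.CriticalPhenomena.PercolationContinuityZ3.Theorems.SahiGrid3
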